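import Literature.AlgebraicGeometry.HodgeTheory.TotallyRealMaxSubfieldHodgeLieAlgebra
import Literature.AlgebraicGeometry.HodgeTheory.GluedBlocksDivisorClasses
import Literature.AlgebraicGeometry.HodgeTheory.RealMultiplicationPowersHodgeClasses
import HarnessLib

/-!
# Hodge classes on the powers of an abelian variety whose endomorphism algebra contains a totally real self-commutant subfield of degree `dim` are generated by divisor classes — V. K. Murty 1988 Thm. 2, case `m = 1`, PROVED (the Lie step in the word model with glued blocks, and the unconditional assembly)

Family `hodge`, layer `Literature/AlgebraicGeometry/HodgeTheory`. Research context: cell `pub-hodge-ring2`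
(HONEST FRAMING: research route conditional on HC_CM; not a corollary; Q11.4-sentence-2 already refuted in
dim ≥ 3), Literature lane, programme R6 — the ASSEMBLY. UNCONDITIONAL: the tree-light Betti hypotheses `hHD`,
`hI` and the instance `HodgeTensorFacts` are discharged in §3 by the tree theorems
`exists_isReal_hodgeModel_holds`, `hodgePQ_independent_of_hodgeModel_holds`, `hodgeTensorFacts_holds`;
theorems only, no named fact (D-0026); no step towards a summit statement (a published theorem, Murty 1988).

PUBLISHED STATEMENT. V. Kumar Murty, Proc. AMS 104 (1988) 61–68, Thm. 2 (p. 67): «Suppose that `E` is a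
product of totally real fields and that `V` is free over `E` of rank `2m`, `m` odd. Then `Hod(A) = L(A)`. In
particular, `𝓑(Aᵏ) = 𝓓(Aᵏ)` for all `k ≥ 1`» (`E` a maximal commutative semisimple subalgebra of
`End(A) ⊗ ℚ`, `V = H₁(A(ℂ), ℚ)`); p. 66: «The case `m = 1` is a special case of [Hazama, Thm. 4.1]». The
tree held this as the NAMED FACT `Murty1988_hodgeClasses_divisorial_powers_totallyRealMaxSubfield_oddHalfRank`
(`MurtyTotallyRealMaximalSubfieldHodgeClasses`, all `m`); THIS FILE proves the case `m = 1` of its field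
rendering `IsMurtyTypeWith A K φ 1` fact-free: `K` a totally real number field, `φ : K →+* End⁰(A)` its own
commutant, `dim A = [K:ℚ]`. Beyond `End⁰(A) = K` (Ribet 1983 / Hazama 1983, the tree's
`RealMultiplicationPowersHodgeClasses`) this covers the TYPE II MINIMAL case: `End⁰(A)` a totally
indefinite quaternion algebra over a totally real field `F` with `2[F:ℚ] = dim A` and `K ⊃ F` a (totally
real) maximal subfield — abelian surfaces with quaternionic multiplication and all their powers, the atlas row
II(3) of `Summits/HodgeConjecture/HodgeConjecture/Theorems/Ring2AtlasTypeIIRows` (there bound to the named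
fact via `isMurtyTypeWith_of_finrank_eq_dim`).

SETTING AND PROOF. `A` with a Murty packet `(K, φ, 1)`; `B` an abelian variety with slots `g : Fin n → (B ⟶ A)`
(`AVSlots`; `B = A^{N+1}`); `H = H¹(A(ℂ); ℚ)`, `ψ` a polarization, `Θ` a Hodge operator; `H ⊗ ℂ = ⊕_κ V_κ` the
joint eigenspaces of `K` (`jointEigenspace φ κ`, two-dimensional, real) with the class map `cls` and the GLUED
HODGE-ADAPTED bases `b'_κ` of `TotallyRealMaxSubfieldHodgeLieAlgebra.exists_glued_adapted_blockBasis_of_isMurtyTypeWith_one`;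
letters `g_j^* b'_κ r ∈ H¹(B(ℂ); ℂ)` (`rmLetters`), colour = (slot, CLASS).
* §1 `wordDerAt_colourOp_cls_placeRefine_eq_zero`: a class-indicator block family placed in all slots kills
  all slices ⟹ the matrix placed at the positions of that class kills the refined slices (the tree's
  `wordDerAt_colourOp_placeRefine_eq_zero` for class indicators instead of `Pi.single`).
* §2 THE INVARIANCE THEOREM `AVSlots.exists_gluedInvariant_coeff`: every rational `(p,p)`-class on `B`
  (`p ≥ 1`) is `∑_w a(w)·(letters)_w` with `a` killed, slice by slice, by every trace-free `N` placed at the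
  positions of any one class: the rational Lie algebra `𝔞` of the rational coefficient tensor inside
  `𝔰𝔭_{End_Hdg}(H, ψ)` (`annLie`) is admissible (`Θ ∈ 𝔞_ℂ` by descent), so by the glued theorem it contains
  every (class ⊗ `N`) — Hazama 1983 §3 «the i-th component `𝔰𝔩₂` acts on `V_i ⊕ ⋯ ⊕ V_i` diagonally», now
  also across the blocks of `H¹(Aⁿ)`; transported to the adapted letters exactly as in the tree's
  `AVSlots.exists_rmInvariant_coeff`.
* §3 THE ASSEMBLY `AVSlots.gluedHodgeClasses_divisorial`: the classes `b'_κ 0 ⌣ b'_κ 1` and the crossed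
  classes of two slots at blocks of the same class lie in `D¹ ⊗ ℂ` (`GluedBlocksDivisorClasses`:
  `theta_mem_span_rational_oneOne_of_glued`, `intertwiner_one_mem_span_endAlg`), so the classwise first
  fundamental theorem `wordEval_gluedLetters_mem_divisorClassesSpan_of_classwise` puts every rational
  `(p,p)`-class in `Dᵖ(B) ⊗ ℂ`. Consequences: `AVSlots.isDivisorGenerated_of_isMurtyTypeWith_one`,
  `AbelianVariety.isDivisorGenerated_powSucc_of_isMurtyTypeWith_one` (`B•(A^{N+1}) = D•(A^{N+1}) ⊗ ℂ`),
  `hodgeConjectureFor_powSucc_of_isMurtyTypeWith_one` — the statement of the tree's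
  `hodgeConjectureFor_powSucc_of_isMurtyTypeWith` at `m = 1` WITHOUT its fact binder — and
  `hodgeConjectureFor_of_isIsogenous_powSucc_of_isMurtyTypeWith_one` (van Geemen Lemma 3.7).

## References

* [Murty1988] V. Kumar Murty, *The Hodge group of an abelian variety*, Proc. AMS 104 (1988) 61–68 (held
  `paper:doi-10-1090-s0002-9939-1988-0958044-1`), Thm. 2 (p. 67), p. 66. [cite: Murty1988, Thm. 2 (p. 67)]
* [Hazama1983] F. Hazama, Tôhoku Math. J. 35 (1983) 303–308, Thm. (1.1), §3 pp. 305–306, and [5, Thm. 4.1] of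
  Murty's list (Hazama, J. Fac. Sci. Univ. Tokyo 31 (1985)). [cite: Hazama1983, Thm. (1.1) and §3 (pp. 305–306)]
* [MoonenZarhin1999LowDim] B. Moonen, Yu. Zarhin, Math. Ann. 315 (1999), (2.2) Type 2(1), §3 (3.1).
  [cite: MoonenZarhin1999LowDim, (2.2) and §3 (3.1)]
* [Ribet1983] K. A. Ribet, Amer. J. Math. 105 (1983), Thm. 0–1. [cite: Ribet1983, Thm. 0–1]
* [Deligne1982HodgeCycles] P. Deligne, LNM 900 (1982), I §3 Prop. 3.4. [cite: Deligne1982HodgeCycles, I §3 Prop. 3.4]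
* [GoodmanWallachGTM255] R. Goodman, N. R. Wallach, GTM 255 (2009), §4.1.1, Thm. 5.3.3. [cite: GoodmanWallachGTM255, §4.1.1]
* [vanGeemen1994HodgeAV] B. van Geemen, LNM 1594 (1994), §2.4–2.5, Lemma 3.7. [cite: vanGeemen1994HodgeAV, Lemma 3.7]
* [Deligne2000] P. Deligne, The Hodge conjecture (Clay problem statement), §1. [cite: Deligne2000, §1]
-/

noncomputable section

open scoped TensorProduct
open CategoryTheory Module NumberField

namespace Literature.AlgebraicGeometry.HodgeTheory

open Literature.AlgebraicTopology.SingularHomology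
open Literature.AlgebraicGeometry.Motives (IsSmoothProjective AbelianVariety bettiCohomology
  ofRatClassBaseChange ofRatClassBaseChange_tmul HodgeTensorFacts hodgeTensorFacts_holds)
open Literature.Barriers.HodgeConjecture
open Literature.AlgebraicGeometry.Motives.HodgeStructure
open Literature.AlgebraicGeometry.ComplexMultiplication
open Literature.RepresentationTheory.GeneralLinear
open Literature.NumberTheory.DiophantineGeometry

/-! ### §1 Class-indicator block families placed in all slots, read along slot-and-block words -/

section WordModel

variable {K : Type*} {J T : Type*} {N d : ℕ}

/-- **The block of class `c`, placed in all slots, kills all slices ⟹ the matrix placed at the positions of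
class `c` (`colourOp` for the colouring slot-and-block word ↦ class) kills all refined slices** (the tree's
`wordDerAt_colourOp_placeRefine_eq_zero` with `Pi.single τ N` replaced by the class indicator).
[cite: GoodmanWallachGTM255, §4.1.1] [cite: Hazama1983, §3 (p. 306)] -/
theorem wordDerAt_colourOp_cls_placeRefine_eq_zero [Field K] [Fintype T] [DecidableEq T] (φ : Fin N ≃ T × Fin 2)
    {a : (Fin d → J × Fin N) → K} (cls : T → T) (c : T) (Nc : Matrix (Fin 2) (Fin 2) K)
    (h : ∀ u : Fin d → J, wordDerAt K (fun _ : Fin d => blockLift φ (fun τ => if cls τ = c then Nc else 0))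
      (wordSlice a u) = 0)
    (U : Fin d → J × T) :
    wordDerAt K (colourOp K (fun t => cls (U t).2) c Nc) (wordSlice (placeRefine φ a) U) = 0 := by
  funext η
  set ε : Word N d := fun t => φ.symm ((U t).2, η t) with hε
  have h1 := congrFun (h fun t => (U t).1) ε
  rw [wordDerAt_blockLift_wordSlice] at h1
  have hU : (fun t => ((U t).1, (φ (ε t)).1)) = U := funext fun t => by
    rw [hε, Equiv.apply_symm_apply]
  have hη : (fun t => (φ (ε t)).2) = η := funext fun t => by rw [hε, Equiv.apply_symm_apply]
  have hfam : (fun t => (fun τ => if cls τ = c then Nc else 0) (φ (ε t)).1) =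
      colourOp K (fun t => cls (U t).2) c Nc := funext fun t => by
    rw [colourOp_apply, hε, Equiv.apply_symm_apply]
  rw [hU, hη, hfam] at h1
  rw [h1, Pi.zero_apply, Pi.zero_apply]

end WordModel

/-! ### §2 The invariance theorem for abelian varieties with slots over `A`, for glued block data -/

section Invariance

variable {A B : AbelianVariety ℂ} {n : ℕ} {g : Fin n → (B ⟶ A)}
variable {ι : Type} [Fintype ι] [DecidableEq ι] {T : ι → Submodule ℂ (ℂ ⊗[ℚ] bettiCohomology A.X 1)}

/-- The two elements of `Fin 2`. [folklore] -/
private theorem fin2_eq_zero_or_one' (r : Fin 2) : r = 0 ∨ r = 1 := by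
  fin_cases r <;> simp

open scoped Classical in
/-- **The INVARIANCE THEOREM for glued blocks (Murty 1988 Thm. 2, `m = 1` / Hazama 1983 §3, Lie step, for
abelian varieties with slots over `A`).** Let `H¹(A(ℂ); ℚ) ⊗ ℂ = ⊕_k T_k` be an internal decomposition into
two-dimensional blocks with Hodge-adapted bases `b'_k` (`b'_k 0 ∈ H^{1,0}`, `b'_k 1 ∈ H^{0,1}`), `cls : ι → ι`,
`ψ` a polarization and `Θ` a Hodge operator such that (`hLie`) for EVERY bracket-closed rational `ψ`-skew
`𝔤 ⊆ End_ℚ(H¹)` commuting with `End_Hdg(H¹)` with `Θ ∈ 𝔤_ℂ`, every class-indicator operator (trace-free `N` on the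
blocks of one class, `0` elsewhere) lies in `𝔤_ℂ`. Let `B` carry slots `g` over `A`. Then every rational class
`c` of type `(p,p)` on `B` (`p ≥ 1`) is `∑_w a(w) · (g b')_w` for a coefficient function `a` on words in the
letters `((j, k), r)` such that for every slot-and-block word `U`, every `col : ι` and every trace-free
`N ∈ M₂(ℂ)`, the operator `N` placed at the positions `t` with `cls (U t).2 = col` kills the slice `a(U, −)`.
Proof = the tree's `AVSlots.exists_rmInvariant_coeff` with THEOREM L replaced by `hLie` applied to the
annihilator algebra `𝔞` of the rational coefficient tensor (`annLie`, admissible: `commutator_mem_annLie`,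
`mem_spanC_annLie`) and `wordDerAt_eq_zero_of_mem_spanC_annLie`. [cite: Murty1988, Thm. 2 (p. 67)]
[cite: Hazama1983, Thm. (1.1) and §3 (pp. 305–306)] [cite: Deligne1982HodgeCycles, I §3 Prop. 3.4]
[cite: MoonenZarhin1999LowDim, §3 (3.1)] -/
theorem AVSlots.exists_gluedInvariant_coeff [HodgeTensorFacts.{0, 0}] (hg : AVSlots A B g)
    (hHD : exists_isReal_hodgeModel) (hI : hodgePQ_independent_of_hodgeModel)
    (ψ : (BettiUniverse.hodge hHD (AbelianVariety.isSmoothProjective_holds (A := A)) 1).Polarization)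
    (hint : DirectSum.IsInternal T) (b : ∀ k, Module.Basis (Fin 2) ℂ (T k))
    (hb0 : ∀ k, (b k 0 : ℂ ⊗[ℚ] bettiCohomology A.X 1) ∈
      (BettiUniverse.hodge hHD (AbelianVariety.isSmoothProjective_holds (A := A)) 1).piece 1 0)
    (hb1 : ∀ k, (b k 1 : ℂ ⊗[ℚ] bettiCohomology A.X 1) ∈
      (BettiUniverse.hodge hHD (AbelianVariety.isSmoothProjective_holds (A := A)) 1).piece 0 1)
    (cls : ι → ι) {Θ : Module.End ℂ (ℂ ⊗[ℚ] bettiCohomology A.X 1)}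
    (hΘ : ∀ p, ∀ x ∈ (BettiUniverse.hodge hHD (AbelianVariety.isSmoothProjective_holds (A := A)) 1).piece p
      (((1 : ℕ) : ℤ) - p), Θ x = ((2 * p - ((1 : ℕ) : ℤ) : ℤ) : ℂ) • x)
    (hLie : ∀ 𝔤 : Submodule ℚ (Module.End ℚ (bettiCohomology A.X 1)),
      (∀ X ∈ 𝔤, ∀ Y ∈ 𝔤, X * Y - Y * X ∈ 𝔤) → Θ ∈ spanC 𝔤 →
      (∀ X ∈ 𝔤, ∀ a : (BettiUniverse.hodge hHD (AbelianVariety.isSmoothProjective_holds (A := A)) 1).endAlg,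
        X * (a : Module.End ℚ (bettiCohomology A.X 1)) = (a : Module.End ℚ (bettiCohomology A.X 1)) * X) →
      (∀ X ∈ 𝔤, ∀ v w, ψ.form (X v) w + ψ.form v (X w) = 0) →
      ∀ (k₀ : ι) (N : Matrix (Fin 2) (Fin 2) ℂ), N.trace = 0 →
        RealPlaces.assemble hint b (fun k => if cls k = cls k₀ then N else 0) ∈ spanC 𝔤)
    {p : ℕ} (hp : 0 < p) {c : complexBetti B.X (2 * p)} (hcQ : IsRationalClass c)
    (hc : IsOfHodgeType B.dim B.X (2 * p) p p c) :
    ∃ a : (Fin (2 * p) → (Fin n × ι) × Fin 2) → ℂ,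
      wordEval (cupPowOneAlt ℂ (Motives.ComplexPoints B.X) (2 * p)) (rmLetters g b) a = c ∧
      ∀ (U : Fin (2 * p) → Fin n × ι) (col : ι) (N : Matrix (Fin 2) (Fin 2) ℂ), N.trace = 0 →
        wordDerAt ℂ (colourOp ℂ (fun t => cls (U t).2) col N) (wordSlice a U) = 0 := by
  classical
  -- the setting
  have hX : IsSmoothProjective A.dim A.X := AbelianVariety.isSmoothProjective_holds
  haveI : Module.Finite ℚ (bettiCohomology A.X 1) := finite_bettiCohomology_one A
  set F := cupPowOneAlt ℂ (Motives.ComplexPoints B.X) (2 * p) with hFdef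
  have hFinj : Function.Injective (exteriorPower.alternatingMapLinearEquiv F) :=
    injective_alternatingMapLinearEquiv_cupPowOneAlt B (2 * p)
  -- bases: the block basis `cbσ` and the rational basis `eC`, both indexed by `Fin M`
  set cbx : Module.Basis (ι × Fin 2) ℂ (ℂ ⊗[ℚ] bettiCohomology A.X 1) :=
    (hint.collectedBasis b).reindex (Equiv.sigmaEquivProd ι (Fin 2)) with hcbx
  set eQ := Module.finBasis ℚ (bettiCohomology A.X 1) with heQ
  set eC : Module.Basis (Fin (Module.finrank ℚ (bettiCohomology A.X 1))) ℂ
    (ℂ ⊗[ℚ] bettiCohomology A.X 1) := Algebra.TensorProduct.basis ℂ eQ with heC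
  set φ : Fin (Module.finrank ℚ (bettiCohomology A.X 1)) ≃ ι × Fin 2 := eC.indexEquiv cbx with hφ
  set cbσ : Module.Basis (Fin (Module.finrank ℚ (bettiCohomology A.X 1))) ℂ
    (ℂ ⊗[ℚ] bettiCohomology A.X 1) := cbx.reindex φ.symm with hcbσdef
  have hcbx : ∀ τr : ι × Fin 2, (cbx τr : ℂ ⊗[ℚ] bettiCohomology A.X 1) = b τr.1 τr.2 := by
    rintro ⟨τ, r⟩
    simp [cbx, DirectSum.IsInternal.collectedBasis_coe, Equiv.sigmaEquivProd]
  have hcbσ : ∀ m, (cbσ m : ℂ ⊗[ℚ] bettiCohomology A.X 1) = b (φ m).1 (φ m).2 := fun m => by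
    rw [hcbσdef, Module.Basis.reindex_apply, Equiv.symm_symm, hcbx]
  -- letters
  set ρ := ofRatClassBaseChangeEquiv hX 1 with hρ
  set v : Module.Basis _ ℂ (complexBetti A.X 1) := cbσ.map ρ with hv
  set eL : Module.Basis _ ℂ (complexBetti A.X 1) := eC.map ρ with heL
  have heLQ : ∀ i, IsRationalClass (eL i) := fun i => by
    rw [heL, Module.Basis.map_apply, heC, Algebra.TensorProduct.basis_apply, hρ,
      ofRatClassBaseChangeEquiv_apply, ofRatClassBaseChange_tmul, one_smul]
    exact isRationalClass_ofRatClass _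
  set κ : Fin (Module.finrank ℚ (bettiCohomology A.X 1)) → Fin 2 := fun m => (φ m).2 with hκ
  have hv_apply : ∀ m, v m = ofRatClassBaseChange (Motives.ComplexPoints A.X) 1
      (b (φ m).1 (φ m).2 : ℂ ⊗[ℚ] bettiCohomology A.X 1) := fun m => by
    rw [hv, Module.Basis.map_apply, hcbσ, hρ, ofRatClassBaseChangeEquiv_apply]
  have hv0 : ∀ m, κ m = 0 → IsOfHodgeType A.dim A.X 1 1 0 (v m) := by
    intro m hm
    rw [hv_apply, ← BettiUniverse.mem_hodge_piece_iff hHD hI hX (k := 1) (p := 1) (q := 0) rfl]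
    have h := hb0 (φ m).1
    change (φ m).2 = 0 at hm
    rw [← hm] at h
    exact h
  have hv1 : ∀ m, κ m = 1 → IsOfHodgeType A.dim A.X 1 0 1 (v m) := by
    intro m hm
    rw [hv_apply, ← BettiUniverse.mem_hodge_piece_iff hHD hI hX (k := 1) (p := 0) (q := 1) rfl]
    have h := hb1 (φ m).1
    change (φ m).2 = 1 at hm
    rw [← hm] at h
    exact h
  -- (α) an antisymmetric kind-balanced coefficient function in the adapted letters
  obtain ⟨ax, hax_bal, hax_anti, hcax⟩ := hg.exists_antisymm_kindBalanced_wordEval_eq v κ hv0 hv1 hp hc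
  -- the change of letters to the rational letters
  set G : Matrix _ _ ℂ := eC.toMatrix cbσ with hG
  set G' : Matrix _ _ ℂ := cbσ.toMatrix eC with hG'
  have hG'G : G' * G = 1 := cbσ.toMatrix_mul_toMatrix_flip eC
  have hve : ∀ m, v m = ∑ i, G i m • eL i := fun m => by
    simp only [hv, heL, Module.Basis.map_apply, ← map_smul, ← map_sum]
    congr 1
    exact (eC.sum_toMatrix_smul_self (v := ⇑cbσ) (j := m)).symm
  have hletters : ∀ j m, avLetters g v (j, m) = ∑ i, G i m • avLetters g eL (j, i) :=
    avLetters_baseChange g G hve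
  set aE := colourChangeAt (fun _ : Fin n => G) ax with haE
  have haE_anti : IsAntisymm aE := hax_anti.colourChangeAt _
  have hcaE : wordEval F (avLetters g eL) aE = c := by
    rw [haE, ← wordEval_eq_wordEval_colourChangeAt F (fun _ : Fin n => G) hletters ax, hcax]
  -- rationality of `aE`
  obtain ⟨q, hq⟩ := hg.exists_rat_wordEval_eq eL heLQ hcQ
  obtain ⟨q', -, haEq⟩ := haE_anti.exists_eq_algebraMap_of_wordEval_eq hFinj (hg.letterBasis eL)
    (q := q) (by rw [AVSlots.coe_letterBasis, hcaE, hFdef, hq])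
  have hslice_e : ∀ u, wordSlice aE u = wordRepAt ℂ (fun _ : Fin (2 * p) => G) (wordSlice ax u) :=
    fun u => wordSlice_colourChangeAt (fun _ : Fin n => G) ax u
  -- the Hodge operator `Θ`: `diag(±1)` in the adapted letters
  have hΘb : ∀ m, Θ (cbσ m) = (if κ m = 0 then (1 : ℂ) else -1) • cbσ m := by
    intro m
    rw [hcbσ]
    change Θ _ = (if (φ m).2 = 0 then (1 : ℂ) else -1) • _
    rcases fin2_eq_zero_or_one' (φ m).2 with h0 | h1
    · rw [h0, if_pos rfl]
      have hmem : (b (φ m).1 0 : ℂ ⊗[ℚ] bettiCohomology A.X 1) ∈ (BettiUniverse.hodge hHD (AbelianVariety.isSmoothProjective_holds (A := A)) 1).piece 1 (((1 : ℕ) : ℤ) - 1) := by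
        have e : (((1 : ℕ) : ℤ) - 1) = 0 := by norm_num
        rw [e]; exact hb0 _
      rw [hΘ 1 _ hmem]
      norm_num
    · rw [h1, if_neg one_ne_zero]
      have hmem : (b (φ m).1 1 : ℂ ⊗[ℚ] bettiCohomology A.X 1) ∈ (BettiUniverse.hodge hHD (AbelianVariety.isSmoothProjective_holds (A := A)) 1).piece 0 (((1 : ℕ) : ℤ) - 0) := by
        have e : (((1 : ℕ) : ℤ) - 0) = 1 := by norm_num
        rw [e]; exact hb1 _
      rw [hΘ 0 _ hmem]
      norm_num
  have hΘcb : LinearMap.toMatrix cbσ cbσ Θ = kindDiag κ := by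
    ext i m
    rw [LinearMap.toMatrix_apply, hΘb, map_smul, Module.Basis.repr_self, Finsupp.smul_apply,
      Finsupp.single_apply, kindDiag, Matrix.diagonal_apply, smul_eq_mul, mul_ite, mul_one, mul_zero]
    by_cases him : i = m
    · subst him; rw [if_pos rfl]
    · rw [if_neg (Ne.symm him), if_neg him]
  have hJG : LinearMap.toMatrix eC eC Θ * G = G * kindDiag κ := by
    rw [← hΘcb, hG, linearMap_toMatrix_mul_basis_toMatrix, basis_toMatrix_mul_linearMap_toMatrix]
  have hΘq : ∀ u : Fin (2 * p) → Fin n, wordDerAt ℂ (fun _ : Fin (2 * p) => LinearMap.toMatrix eC eC Θ)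
      (wordSlice (fun w => algebraMap ℚ ℂ (q' w)) u) = 0 := by
    intro u
    rw [← haEq, hslice_e]
    refine wordDerAt_wordRepAt_eq_zero_of_mul_eq ℂ (fun _ : Fin (2 * p) => G) (fun _ => hJG) ?_
    rw [wordDerAt_const]
    exact wordDer_kindDiag_wordSlice_eq_zero κ hax_bal u
  -- the annihilator algebra `𝔞` of the rational tensor `q'` inside `𝔰𝔭_{End_Hdg}(H¹, ψ)` is admissible
  set 𝔞 : Submodule ℚ (Module.End ℚ (bettiCohomology A.X 1)) :=
    annLie ψ.form eQ (fun a : (BettiUniverse.hodge hHD (AbelianVariety.isSmoothProjective_holds (A := A)) 1).endAlg => (a : Module.End ℚ (bettiCohomology A.X 1))) q' with h𝔞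
  have hΘC : Θ ∈ (BettiUniverse.hodge hHD (AbelianVariety.isSmoothProjective_holds (A := A)) 1).hodgeLieC := (BettiUniverse.hodge hHD (AbelianVariety.isSmoothProjective_holds (A := A)) 1).mem_hodgeLieC_of_forall_piece hΘ
  have hΘ𝔞 : Θ ∈ spanC 𝔞 :=
    mem_spanC_annLie ψ.form eQ _ q' hΘq (fun a => commute_baseChange_of_mem_hodgeLieC (BettiUniverse.hodge hHD (AbelianVariety.isSmoothProjective_holds (A := A)) 1) hΘC a)
      fun x y => by rw [formBaseChange_skew_of_mem_hodgeLieC ψ hΘC, neg_add_cancel]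
  have hbr : ∀ X ∈ 𝔞, ∀ X' ∈ 𝔞, X * X' - X' * X ∈ 𝔞 := fun X hX X' hX' =>
    commutator_mem_annLie ψ.form eQ _ q' hX hX'
  have hcomm : ∀ X ∈ 𝔞, ∀ a : (BettiUniverse.hodge hHD (AbelianVariety.isSmoothProjective_holds (A := A)) 1).endAlg,
      X * (a : Module.End ℚ (bettiCohomology A.X 1)) = (a : Module.End ℚ (bettiCohomology A.X 1)) * X :=
    fun X hX a => ((mem_annLie_iff ψ.form eQ _ q' X).1 hX).2.1 a
  have hskew : ∀ X ∈ 𝔞, ∀ v w, ψ.form (X v) w + ψ.form v (X w) = 0 :=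
    fun X hX => ((mem_annLie_iff ψ.form eQ _ q' X).1 hX).2.2
  -- the coefficient function, refined to slot-and-block colours
  refine ⟨placeRefine φ ax, ?_, fun U col N hN => ?_⟩
  · rw [← hcax]
    have hx : (fun jr : (Fin n × ι) × Fin 2 => avLetters g v (jr.1.1, φ.symm (jr.1.2, jr.2))) = rmLetters g b := by
      funext jr
      rw [avLetters_apply, hv_apply, Equiv.apply_symm_apply]
      rfl
    rw [← hx]
    exact wordEval_placeRefine F φ (avLetters g v) ax
  · refine wordDerAt_colourOp_cls_placeRefine_eq_zero φ cls col N (fun u => ?_) U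
    -- the class operator `Y := (class col) ⊗ N` lies in `𝔞_ℂ`
    set Y := RealPlaces.assemble hint b (fun k => if cls k = col then N else 0) with hY
    have hYmem : Y ∈ spanC 𝔞 := by
      by_cases hcol : ∃ k₀, cls k₀ = col
      · obtain ⟨k₀, rfl⟩ := hcol
        exact hLie 𝔞 hbr hΘ𝔞 hcomm hskew k₀ N hN
      · have hzero : (fun k => if cls k = col then N else 0) = (0 : ι → Matrix (Fin 2) (Fin 2) ℂ) :=
          funext fun k => if_neg fun hk => hcol ⟨k, hk⟩
        rw [hY, hzero, map_zero]
        exact Submodule.zero_mem _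
    have hL := wordDerAt_eq_zero_of_mem_spanC_annLie ψ.form eQ _ q' hYmem u
    rw [← haEq, hslice_e] at hL
    have hYG : ∀ _t : Fin (2 * p), LinearMap.toMatrix eC eC Y * G = G * LinearMap.toMatrix cbσ cbσ Y :=
      fun _ => by rw [hG, linearMap_toMatrix_mul_basis_toMatrix, basis_toMatrix_mul_linearMap_toMatrix]
    have hblk : LinearMap.toMatrix cbσ cbσ Y = blockLift φ (fun k => if cls k = col then N else 0) :=
      toMatrix_assemble_eq_blockLift hint b φ cbσ hcbσ _
    have h3 : wordRepAt ℂ (fun _ : Fin (2 * p) => G)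
        (wordDerAt ℂ (fun _ : Fin (2 * p) => blockLift φ (fun k => if cls k = col then N else 0))
          (wordSlice ax u)) = 0 := by
      rw [← hblk, wordRepAt_wordDerAt_of_mul_eq ℂ (fun _ : Fin (2 * p) => G) hYG, hL]
    exact wordRepAt_injective ℂ (g := fun _ : Fin (2 * p) => G) (g' := fun _ : Fin (2 * p) => G')
      (funext fun _ => hG'G) (by rw [h3, map_zero])

end Invariance

/-! ### §3 The unconditional assembly: `B•(Aⁿ) = D•(Aⁿ) ⊗ ℂ` and the Hodge conjecture for the powers (Murty 1988 Thm. 2, `m = 1`) -/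

section Assembly

variable {A B : AbelianVariety ℂ} {n : ℕ} {g : Fin n → (B ⟶ A)} {K : Type} [Field K] [NumberField K]
  {φ : K →+* A.endAlgebra}

/-- **`Bᵖ(B) ⊆ Dᵖ(B) ⊗ ℂ` for an abelian variety `B` with slots over an abelian variety `A` with a Murty packet
`(K, φ, 1)`** (in particular `B = Aⁿ`): every rational class of type `(p,p)` in `H²ᵖ(B(ℂ); ℂ)` is a
`ℂ`-combination of products of `p` rational `(1,1)`-classes. Murty 1988 Thm. 2 (`m = 1`): «`𝓑(Aᵏ) = 𝓓(Aᵏ)` for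
all `k ≥ 1`»; Hazama 1983 §3. Assembled from the glued Lie theorem
(`exists_glued_adapted_blockBasis_of_isMurtyTypeWith_one`), the invariance theorem
`AVSlots.exists_gluedInvariant_coeff`, the degree-two theorems of `GluedBlocksDivisorClasses` and the classwise
first fundamental theorem; `hHD`, `hI`, `HodgeTensorFacts` discharged. [cite: Murty1988, Thm. 2 (p. 67)]
[cite: Hazama1983, Thm. (1.1) and §3 (pp. 305–306)] [cite: MoonenZarhin1999LowDim, (2.2) and §3 (3.1)] -/
theorem AVSlots.gluedHodgeClasses_divisorial (hg : AVSlots A B g) (hA : IsMurtyTypeWith A K φ 1)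
    (p : ℕ) (c : complexBetti B.X (2 * p)) (hcQ : IsRationalClass c)
    (hc : IsOfHodgeType B.dim B.X (2 * p) p p c) :
    c ∈ divisorClassesSpan B.X B.dim p := by
  classical
  rcases Nat.eq_zero_or_pos p with rfl | hp
  · exact AbelianVariety.mem_divisorClassesSpan_zero B c
  have hHD : exists_isReal_hodgeModel := exists_isReal_hodgeModel_holds
  have hI : hodgePQ_independent_of_hodgeModel := hodgePQ_independent_of_hodgeModel_holds
  haveI : HodgeTensorFacts.{0, 0} := hodgeTensorFacts_holds.{0, 0}
  haveI : Module.Finite ℚ (bettiCohomology A.X 1) := finite_bettiCohomology_one A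
  have hX : IsSmoothProjective A.dim A.X := AbelianVariety.isSmoothProjective_holds
  set H := BettiUniverse.hodge hHD (AbelianVariety.isSmoothProjective_holds (A := A)) 1 with hH
  -- a polarization of `H¹(A(ℂ); ℚ)` and a Hodge operator
  obtain ⟨ψ⟩ : H.IsPolarizable :=
    smoothProjective_hodgeStructure_isPolarizable_holds hX (BettiUniverse.realHodgeModel hHD hX)
      (BettiUniverse.realHodgeModel_isHodgeSymmetric hHD hX) 1
  obtain ⟨Θ, hΘ⟩ := exists_hodgeTheta H
  -- glued Hodge-adapted block bases of the joint eigenspaces of `K`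
  obtain ⟨cls, b', hb0, hb1, -, hall⟩ :=
    exists_glued_adapted_blockBasis_of_isMurtyTypeWith_one φ hA hHD hI ψ hΘ
  have hint : DirectSum.IsInternal (jointEigenspace (A := A) φ) := isInternal_jointEigenspace φ hHD hI
  -- `Lie Hg(A)` is admissible: its glued form
  have hΘC : Θ ∈ spanC H.hodgeLie := H.mem_hodgeLieC_of_forall_piece hΘ
  obtain ⟨-, hglue, hreach⟩ := hall H.hodgeLie (fun X hX Y hY => H.commutator_mem_hodgeLie hX hY) hΘC
    (fun X hX a => H.commute_of_mem_hodgeLie hX a) (fun X hX v w => form_apply_add_eq_zero_of_mem_hodgeLie ψ hX v w)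
  have hT : ∀ X ∈ H.hodgeLie, ∀ k, Set.MapsTo (X.baseChange ℂ) (jointEigenspace φ k) (jointEigenspace φ k) :=
    fun X hX k => mapsTo_jointEigenspace_of_forall_commute φ hHD hI (fun a => H.commute_of_mem_hodgeLie hX a) k
  have hglue' : ∀ X ∈ H.hodgeLie, ∀ k k', cls k = cls k' →
      RealPlaces.blockMat hint b' (X.baseChange ℂ) k = RealPlaces.blockMat hint b' (X.baseChange ℂ) k' :=
    fun X hX k k' hkk' => hglue _ (baseChange_mem_spanC hX) k k' hkk'
  have hreach' : ∀ (k₀ : K →+* ℂ) (N : Matrix (Fin 2) (Fin 2) ℂ), N.trace = 0 →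
      RealPlaces.assemble hint b' (fun k => if cls k = cls k₀ then N else 0) ∈ H.hodgeLieC :=
    fun k₀ N hN => hreach k₀ N hN
  -- degree two: `θ_k` and the elementary intertwiners
  have hθ := theta_mem_span_rational_oneOne_of_glued hHD hI ψ hint b' hb0 hb1 cls hT hreach' hglue'
  have hu : ∀ k₁ k₂, cls k₁ = cls k₂ → RealPlaces.intertwiner hint b' k₁ k₂ 1 ∈
      Submodule.span ℂ ((fun a : Module.End ℚ (bettiCohomology A.X 1) => a.baseChange ℂ) ''
        (H.endAlg : Set (Module.End ℚ (bettiCohomology A.X 1)))) :=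
    fun k₁ k₂ hk => intertwiner_one_mem_span_endAlg hHD hint b' cls hT hglue' hk
  -- the Lie step: a classwise `𝔰𝔩₂`-invariant coefficient function
  obtain ⟨a, hca, hkill⟩ := hg.exists_gluedInvariant_coeff hHD hI ψ hint b' hb0 hb1 cls hΘ
    (fun 𝔤 hbr hΘ𝔤 hcomm hskew => (hall 𝔤 hbr hΘ𝔤 hcomm hskew).2.2) hp hcQ hc
  rw [← hca]
  -- the cycle step: the classwise first fundamental theorem
  exact wordEval_gluedLetters_mem_divisorClassesSpan_of_classwise g hHD hI hint b' hθ cls hu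
    (fun U col => hkill U col _ (by simp)) (fun U col => hkill U col _ (by simp))

/-- **`IsDivisorGenerated B`** for every abelian variety `B` with slots over an abelian variety with a Murty
packet `(K, φ, 1)` (the tree's spelling of `B•(B) = D•(B) ⊗ ℂ`). [cite: Murty1988, Thm. 2 (p. 67)]
[cite: Hazama1983, Thm. (1.1)] -/
theorem AVSlots.isDivisorGenerated_of_isMurtyTypeWith_one (hg : AVSlots A B g) (hA : IsMurtyTypeWith A K φ 1) :
    IsDivisorGenerated B :=
  fun p c hcQ hc => hg.gluedHodgeClasses_divisorial hA p c hcQ hc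

variable (A) in
/-- **V. K. Murty 1988, Thm. 2, case `m = 1`, for all powers, PROVED: `B•(A^{N+1}) = D•(A^{N+1}) ⊗ ℂ`** for a
complex abelian variety `A` whose endomorphism algebra contains a totally real number field `K` as its own
commutant with `[K:ℚ] = dim A`. This is the `m = 1` case of the tree's named fact
`Murty1988_hodgeClasses_divisorial_powers_totallyRealMaxSubfield_oddHalfRank` in its field rendering
`IsMurtyTypeWith` — the statement of `isDivisorGenerated_powSucc_of_isMurtyTypeWith` at `m = 1` WITHOUT its
fact binder. [cite: Murty1988, Thm. 2 (p. 67)] [cite: Hazama1983, Thm. (1.1) and §3 (pp. 305–306)]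
[cite: MoonenZarhin1999LowDim, (2.2) and §3 (3.1)] -/
theorem AbelianVariety.isDivisorGenerated_powSucc_of_isMurtyTypeWith_one (hA : IsMurtyTypeWith A K φ 1)
    (N : ℕ) : IsDivisorGenerated (A.powSucc N) :=
  (AVSlots.powSucc A N).isDivisorGenerated_of_isMurtyTypeWith_one hA

variable (A) in
/-- `A` itself: `B•(A) = D•(A) ⊗ ℂ`. [cite: Murty1988, Thm. 2 (p. 67)] -/
theorem AbelianVariety.isDivisorGenerated_of_isMurtyTypeWith_one (hA : IsMurtyTypeWith A K φ 1) :
    IsDivisorGenerated A :=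
  (avSlots_self A).isDivisorGenerated_of_isMurtyTypeWith_one hA

/-- **The Hodge conjecture for all powers `A^{N+1}` of a complex abelian variety with a Murty packet
`(K, φ, 1)` — UNCONDITIONAL** (`B = D` just proved, and `D ⊗ ℂ ⊆` algebraic classes by the tree's
`hodgeConjectureFor_of_isDivisorGenerated`; Murty's Remark 1, p. 62). This is the statement of the tree's
`hodgeConjectureFor_powSucc_of_isMurtyTypeWith` (`MurtyTotallyRealMaximalSubfieldHodgeClasses` §4) at
`m = 1` without its fact binder. [cite: Murty1988, Thm. 2 and §1 Remark 1] [cite: vanGeemen1994HodgeAV, §2.4]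
[cite: Deligne2000, §1] -/
theorem hodgeConjectureFor_powSucc_of_isMurtyTypeWith_one (hA : IsMurtyTypeWith A K φ 1) (N : ℕ) :
    HodgeConjectureFor (A.powSucc N).dim (A.powSucc N).X :=
  hodgeConjectureFor_of_isDivisorGenerated _
    (AbelianVariety.isDivisorGenerated_powSucc_of_isMurtyTypeWith_one A hA N)

/-- **Instance `N = 0`: the Hodge conjecture for `A` itself** under a Murty packet `(K, φ, 1)`, unconditional.
[cite: Murty1988, Thm. 2 and §1 Remark 1] -/
theorem hodgeConjectureFor_self_of_isMurtyTypeWith_one (hA : IsMurtyTypeWith A K φ 1) :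
    HodgeConjectureFor A.dim A.X :=
  hodgeConjectureFor_powSucc_of_isMurtyTypeWith_one hA 0

/-- **The Hodge conjecture for every complex abelian variety isogenous to such a power** (van Geemen
Lemma 3.7 = the tree's `HodgeConjectureFor.of_isIsogenous`). [cite: vanGeemen1994HodgeAV, Lemma 3.7]
[cite: Murty1988, Thm. 2 (p. 67)] -/
theorem hodgeConjectureFor_of_isIsogenous_powSucc_of_isMurtyTypeWith_one {B' : AbelianVariety ℂ}
    (hA : IsMurtyTypeWith A K φ 1) {N : ℕ} (hB : B'.IsIsogenous (A.powSucc N)) :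
    HodgeConjectureFor B'.dim B'.X :=
  HodgeConjectureFor.of_isIsogenous hB (hodgeConjectureFor_powSucc_of_isMurtyTypeWith_one hA N)

end Assembly

end Literature.AlgebraicGeometry.HodgeTheory

end
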